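import Summits.Ventures.Crystal3D.Kissing125.GSearchDefs2
import Summits.Ventures.Crystal3D.Kissing125.GSearchRelabel3
import HarnessLib

/-!
# Soundness of bisection and of the search, κ-generic — part 1/3

HONEST FRAMING (cell pub-crystal3d, K-path at `h = 5/4`, V4 = κ as an explicit parameter): this is NOT a result printed
by Hales; it is his METHOD (arXiv:1209.6043, Theorem 3 + Lemmas 7–10, in the tree's form of a verified interval-arithmetic
growth search, `Literature/…/KissingSearch*.lean`) with the largest long-side cosine `κ` made an EXPLICIT PARAMETER
(`κ : Kappa`, carrying the two numeric facts the soundness proof uses: `-1/2 ≤ κ`, `κ < 1/4`).  Only the declarations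
whose statement depends on `κ` are declared here (namespace `…Kissing125.GSearch`, the tree's short names, no renames);
every κ-free helper is the landed K25 copy (`…Kissing125.KissingSearch.*`) and every κ-free lemma is cited from the tree
(PRIVATE per-file citation aliases; `GSearchTransport.lean` holds `toT : St → tree St` and the transport equalities).  The K25
instance is `κ25 = ⟨7/32, …⟩`; `GSearchBridge.lean` identifies the generic checker at
`κ25` with the landed `Kissing125.KissingSearch.checkPart`, so the landed run files are consumed unchanged.  Generated by
`HOME/lean/kissing125/v4-prep/gen/mkgen.py`; nothing here is asserted about GAP(1.26) or any census.

THIS FILE: the κ-tainted declarations of `Literature/Geometry/DiscreteGeometry/KissingSearchSearch.lean` (part 1 of 3), with `κ : Kappa` threaded; κ-free declarations of that file are NOT re-declared publicly (the κ-free helpers are the landed K25 copies; the κ-free tree lemmas used by the proofs are cited through PRIVATE aliases at the top of the file).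

## References
* T. C. Hales, *A proof of Fejes Tóth's conjecture on sphere packings with kissing number twelve*,
  arXiv:1209.6043 (2012): Definition 1, Theorem 2, Theorem 3, Lemmas 7–10. [`Hales2012`]
* R. E. Moore, *Interval Analysis* (1966), Theorem 3.1, §4.4. [`Moore1966`]
-/

namespace Summit.Ventures.Crystal3D.Kissing125

open Literature.Geometry.DiscreteGeometry
open Summit.Ventures.Crystal3D.Kissing125.KissingSearch

namespace GSearch

open Real Literature.Analysis.ValidatedNumerics KissingLP NonemptyInterval Finset

variable {κ : Kappa}

/-! ### κ-free tree lemmas used below, read over the K25 copies (PRIVATE citation aliases; the public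
surface of this file is κ-generic only) -/

/-- K25 reading of the tree lemma `apexes_eq` (κ-free; proof = citation of the tree lemma). [folklore] -/
private theorem apexes_eq (s : St) (a b : ℕ) :
  s.apexes a b =
    (List.map (fun t ↦ tv0 t + tv1 t + tv2 t - a - b)
        (List.filter (fun t ↦ tmem t a && tmem t b) s.tris.toList)).reverse :=
  Literature.Geometry.DiscreteGeometry.KissingSearch.apexes_eq (toT s) a b

/-- K25 reading of the tree lemma `eq_of_tset_eq` (κ-free; proof = citation of the tree lemma). [folklore] -/
private theorem eq_of_tset_eq {s t : ℕ} (hs : TriValid s) (ht : TriValid t)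
  (hst : tset s = tset t) : s = t :=
  Literature.Geometry.DiscreteGeometry.KissingSearch.eq_of_tset_eq hs ht hst

/-- K25 reading of the tree lemma `lt_of_mem_tset` (κ-free; proof = citation of the tree lemma). [folklore] -/
private theorem lt_of_mem_tset {t v : ℕ} (ht : TriValid t) (hv : v ∈ tset t) : v < 12 :=
  Literature.Geometry.DiscreteGeometry.KissingSearch.lt_of_mem_tset ht hv

/-- K25 reading of the tree lemma `nused_eq` (κ-free; proof = citation of the tree lemma). [folklore] -/
private theorem nused_eq (s : St) :
  s.nused = (List.filter (fun v ↦ decide (s.hdeg2 v ≠ 0)) (List.range' 0 12)).length :=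
  by simpa only [nused_tr, hdeg2_tr] using Literature.Geometry.DiscreteGeometry.KissingSearch.nused_eq (toT s)

/-- K25 reading of the tree lemma `third_vertex` (κ-free; proof = citation of the tree lemma). [folklore] -/
private theorem third_vertex {t a b : ℕ} (ht : TriValid t) (ha : a ∈ tset t)
  (hb : b ∈ tset t) (hab : a ≠ b) :
  tv0 t + tv1 t + tv2 t - a - b ∈ tset t ∧
    tv0 t + tv1 t + tv2 t - a - b ≠ a ∧
      tv0 t + tv1 t + tv2 t - a - b ≠ b ∧ tset t = {a, b, tv0 t + tv1 t + tv2 t - a - b} :=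
  Literature.Geometry.DiscreteGeometry.KissingSearch.third_vertex ht ha hb hab

/-- K25 reading of the tree lemma `tmem_iff` (κ-free; proof = citation of the tree lemma). [folklore] -/
private theorem tmem_iff {t v : ℕ} : tmem t v = true ↔ v ∈ tset t :=
  Literature.Geometry.DiscreteGeometry.KissingSearch.tmem_iff


/-! ### Part A. Bookkeeping -/

section Book

variable {M : KConf κ} {s : St}

/-- **Meaning of `chooseOpen = some`**: an open side `{v, a}` (exactly one placed triangle,
`{v, a, b}`). [folklore] -/
theorem chooseOpen_some {M : KConf κ} {s : St} (hR : Realizes M s) {v a b : ℕ} (h : s.chooseOpen = some (v, a, b)) :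
    v < 12 ∧ a < 12 ∧ a ≠ v ∧ s.gsc v a = 1 ∧ ∃ t ∈ s.tris.toList, tset t = {v, a, b} ∧ b < 12 ∧ b ≠ v ∧ b ≠ a := by
  unfold St.chooseOpen at h
  obtain ⟨v', hv', hf⟩ := List.exists_of_findSome?_eq_some h
  rw [List.mem_range] at hv'
  revert hf
  cases hfind : (List.range 12).find? (fun a => a != v' && s.gsc v' a == 1) with
  | none => intro hf; cases hf
  | some a' =>
    simp only
    have hp := List.find?_some hfind
    have ha' := List.mem_of_find?_eq_some hfind
    rw [List.mem_range] at ha'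
    simp only [Bool.and_eq_true, bne_iff_ne, ne_eq, beq_iff_eq] at hp
    cases hap : s.apexes v' a' with
    | nil => intro hf; cases hf
    | cons b' rest =>
      simp only
      intro hf
      cases hf
      refine ⟨hv', ha', hp.1, hp.2, ?_⟩
      have hb : b ∈ s.apexes v a := by rw [hap]; simp
      rw [apexes_eq, List.mem_reverse, List.mem_map] at hb
      obtain ⟨t, ht, hbt⟩ := hb
      rw [List.mem_filter] at ht
      simp only [Bool.and_eq_true] at ht
      have hvt := tmem_iff.1 ht.2.1
      have hat := tmem_iff.1 ht.2.2
      obtain ⟨hm, h1, h2, hset⟩ := third_vertex (hR.valid t ht.1) hvt hat (Ne.symm hp.1)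
      rw [hbt] at hm h1 h2 hset
      exact ⟨t, ht.1, hset, lt_of_mem_tset (hR.valid t ht.1) hm, h1, h2⟩

/-- **Meaning of `chooseOpen = none`**: no side lies in exactly one placed triangle. [folklore] -/
theorem chooseOpen_none {M : KConf κ} {s : St} (hR : Realizes M s) (h : s.chooseOpen = none) {v a : ℕ} (hv : v < 12) (ha : a < 12)
    (hav : a ≠ v) : s.gsc v a ≠ 1 := by
  intro h1
  unfold St.chooseOpen at h
  rw [List.findSome?_eq_none_iff] at h
  have hfv := h v (List.mem_range.2 hv)
  revert hfv
  cases hfind : (List.range 12).find? (fun a => a != v && s.gsc v a == 1) with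
  | none =>
    intro _
    rw [List.find?_eq_none] at hfind
    have := hfind a (List.mem_range.2 ha)
    simp only [Bool.and_eq_true, bne_iff_ne, ne_eq, beq_iff_eq, not_and] at this
    exact this hav h1
  | some a' =>
    simp only
    have hp := List.find?_some hfind
    have ha' := List.mem_of_find?_eq_some hfind
    rw [List.mem_range] at ha'
    simp only [Bool.and_eq_true, bne_iff_ne, ne_eq, beq_iff_eq] at hp
    -- `apexes v a'` is nonempty
    have hne : s.apexes v a' ≠ [] := by
      rw [apexes_eq]
      intro he
      rw [List.reverse_eq_nil_iff, List.map_eq_nil_iff] at he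
      have hl := gsc_eq_length hR hv ha' (Ne.symm hp.1)
      rw [hp.2] at hl
      unfold St.onSideL at hl
      rw [he] at hl
      simp at hl
    cases hap : s.apexes v a' with
    | nil => exact absurd hap hne
    | cons b rest => simp

/-- **Relabelling a realized state by a swap of two unused labels.** [folklore] -/
theorem realizes_swap {M : KConf κ} {s : St} (hR : Realizes M s) {c n : ℕ} (hc : c < 12) (hn : n < 12)
    (hcu : ∀ t ∈ s.tris.toList, c ∉ tset t) (hnu : ∀ t ∈ s.tris.toList, n ∉ tset t) :
    Realizes (M.relabel (Equiv.swap c n) (fun a => by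
      by_cases h1 : a = c
      · subst h1; rw [Equiv.swap_apply_left]; exact ⟨fun _ => hc, fun _ => hn⟩
      · by_cases h2 : a = n
        · subst h2; rw [Equiv.swap_apply_right]; exact ⟨fun _ => hn, fun _ => hc⟩
        · rw [Equiv.swap_apply_of_ne_of_ne h1 h2])) s := by
  have fix : ∀ t ∈ s.tris.toList, relab (Equiv.swap c n) (tset t) = tset t := by
    intro t ht
    unfold relab
    have : ∀ x ∈ tset t, (Equiv.swap c n) x = x := fun x hx =>
      Equiv.swap_apply_of_ne_of_ne (fun e => hcu t ht (e ▸ hx)) (fun e => hnu t ht (e ▸ hx))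
    ext x
    rw [Finset.mem_image]
    constructor
    · rintro ⟨y, hy, rfl⟩; rw [this y hy]; exact hy
    · intro hx; exact ⟨x, hx, this x hx⟩
  -- labelled pairs avoid `c` and `n`
  have fixlab : ∀ p q, p < 12 → q < 12 → p ≠ q → s.gdom p q ≠ UNL →
      (Equiv.swap c n) p = p ∧ (Equiv.swap c n) q = q := by
    intro p q hp hq hpq hl
    obtain ⟨t, ht, hpt, hqt⟩ := hR.lab_side p q hp hq hpq hl
    exact ⟨Equiv.swap_apply_of_ne_of_ne (fun e => hcu t ht (e ▸ hpt)) (fun e => hnu t ht (e ▸ hpt)),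
      Equiv.swap_apply_of_ne_of_ne (fun e => hcu t ht (e ▸ hqt)) (fun e => hnu t ht (e ▸ hqt))⟩
  exact {
    size_dom := hR.size_dom
    size_sc := hR.size_sc
    valid := hR.valid
    mem := fun t ht => by
      show tset t ∈ M.T.image (relab (Equiv.swap c n))
      rw [Finset.mem_image]
      exact ⟨tset t, hR.mem t ht, fix t ht⟩
    nodup := hR.nodup
    sc_eq := hR.sc_eq
    dom := fun p q hp hq hpq => by
      show DomSem κ (s.gdom p q) (M.g ((Equiv.swap c n).symm p) ((Equiv.swap c n).symm q))
      rw [Equiv.symm_swap]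
      by_cases hl : s.gdom p q = UNL
      · exact Or.inl hl
      · obtain ⟨e1, e2⟩ := fixlab p q hp hq hpq hl
        rw [e1, e2]; exact hR.dom p q hp hq hpq
    lab_side := hR.lab_side
    side_lab := hR.side_lab }

end Book

/-! ### Part B. Complete states: accept and refute -/

section Complete

variable {M : KConf κ} {s : St}

/-- **No open side forces every triangle to be placed** (given one placed triangle).
[cite: Hales2012, proof of Lemma 9] -/
theorem all_placed_of_no_open {M : KConf κ} {s : St} (hR : Realizes M s) (hno : ∀ v, v < 12 → ∀ a, a < 12 → a ≠ v → s.gsc v a ≠ 1)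
    (hne : s.tris.toList ≠ []) {t'' : Finset ℕ} (hT : t'' ∈ M.T) : ∃ t ∈ s.tris.toList, tset t = t'' := by
  classical
  set D := (Finset.range 12).filter fun x => ∃ t ∈ s.tris.toList, x ∈ tset t with hD
  have hDsub : D ⊆ Finset.range 12 := Finset.filter_subset _ _
  obtain ⟨t₀, ht₀⟩ := List.exists_mem_of_ne_nil _ hne
  have hDne : D.Nonempty := ⟨tv0 t₀, by
    rw [hD, Finset.mem_filter, Finset.mem_range]
    have h0 : tv0 t₀ ∈ tset t₀ := by unfold tset; simp
    exact ⟨lt_of_mem_tset (hR.valid t₀ ht₀) h0, t₀, ht₀, h0⟩⟩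
  have hcl : ∀ t ∈ M.T, (∃ a ∈ t, a ∈ D) → t ⊆ D := by
    intro t ht ⟨x, hxt, hxD⟩
    rw [hD, Finset.mem_filter, Finset.mem_range] at hxD
    obtain ⟨hx12, tp, htp, hxp⟩ := hxD
    obtain ⟨t₁, ht₁, e⟩ := all_placed_of_closed hR hx12 (fun u hu huv => hno x hx12 u hu huv) htp hxp ht hxt
    intro y hy
    rw [hD, Finset.mem_filter, Finset.mem_range]
    exact ⟨(M.mem_T t ht).2 y hy, t₁, ht₁, by rw [e]; exact hy⟩
  have hDeq := M.conn D hDsub hDne hcl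
  obtain ⟨hc3, hlt⟩ := M.mem_T t'' hT
  obtain ⟨x, hx⟩ : t''.Nonempty := by rw [← Finset.card_pos, hc3]; norm_num
  have hxD : x ∈ D := by rw [hDeq, Finset.mem_range]; exact hlt x hx
  rw [hD, Finset.mem_filter, Finset.mem_range] at hxD
  obtain ⟨hx12, tp, htp, hxp⟩ := hxD
  exact all_placed_of_closed hR hx12 (fun u hu huv => hno x hx12 u hu huv) htp hxp hT hx

/-- The placed triangles form a subset of `M.T` of the same size as the placed list.
[folklore] -/
theorem card_image_tris {M : KConf κ} {s : St} (hR : Realizes M s) :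
    (s.tris.toList.map tset).toFinset ⊆ M.T ∧ (s.tris.toList.map tset).toFinset.card = s.tris.size := by
  constructor
  · intro t'' ht''
    rw [List.mem_toFinset, List.mem_map] at ht''
    obtain ⟨t, ht, rfl⟩ := ht''
    exact hR.mem t ht
  · rw [List.card_toFinset, List.dedup_eq_self.2, List.length_map, Array.length_toList]
    exact (List.nodup_map_iff_inj_on hR.nodup).2 fun t ht t' ht' e => eq_of_tset_eq (hR.valid t ht) (hR.valid t' ht') e

/-- **An unplaced triangle of `M` bounds the number of placed ones by `19`.** [folklore] -/
theorem size_lt_of_unplaced {M : KConf κ} {s : St} (hR : Realizes M s) {t'' : Finset ℕ} (hT : t'' ∈ M.T)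
    (hun : ∀ t ∈ s.tris.toList, tset t ≠ t'') : s.tris.size < 20 := by
  obtain ⟨hsub, hcard⟩ := card_image_tris hR
  have hss : (s.tris.toList.map tset).toFinset ⊂ M.T := by
    refine Finset.ssubset_iff_subset_ne.2 ⟨hsub, fun e => ?_⟩
    have : t'' ∈ (s.tris.toList.map tset).toFinset := by rw [e]; exact hT
    rw [List.mem_toFinset, List.mem_map] at this
    obtain ⟨t, ht, e'⟩ := this
    exact hun t ht e'
  have := Finset.card_lt_card hss
  rw [hcard, M.card_T] at this
  exact this

/-- **A complete state has twenty triangles on twelve labels.** [folklore] -/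
theorem size_and_nused_of_complete {M : KConf κ} {s : St} (hR : Realizes M s) (hall : ∀ t'' ∈ M.T, ∃ t ∈ s.tris.toList, tset t = t'') :
    s.tris.size = 20 ∧ s.nused = 12 := by
  classical
  obtain ⟨hsub, hcard⟩ := card_image_tris hR
  have heq : (s.tris.toList.map tset).toFinset = M.T := by
    refine Finset.Subset.antisymm hsub fun t'' ht'' => ?_
    obtain ⟨t, ht, rfl⟩ := hall t'' ht''
    rw [List.mem_toFinset, List.mem_map]; exact ⟨t, ht, rfl⟩
  refine ⟨by rw [← hcard, heq, M.card_T], ?_⟩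
  rw [nused_eq]
  have : (List.range' 0 12).filter (fun v => s.hdeg2 v ≠ 0) = List.range' 0 12 := by
    rw [List.filter_eq_self]
    intro v hv
    rw [List.mem_range'_1] at hv
    obtain ⟨t'', hT, hv''⟩ := M.cover v (by omega)
    obtain ⟨t, ht, e⟩ := hall t'' hT
    have h := (used_iff_hdeg2 hR (by omega : v < 12)).1 ⟨t, ht, by rw [e]; exact hv''⟩
    simpa using h
  rw [this, List.length_range']

/-- **The decided contact graph of a complete state is the contact graph of `M`.**
[folklore] -/
theorem adjB_iff {M : KConf κ} {s : St} (hR : Realizes M s) (hall : ∀ t'' ∈ M.T, ∃ t ∈ s.tris.toList, tset t = t'') {a b : ℕ}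
    (ha : a < 12) (hb : b < 12) : s.adjB a b = true ↔ (a ≠ b ∧ M.g a b = 1 / 2) := by
  unfold St.adjB
  simp only [Bool.and_eq_true, bne_iff_ne, ne_eq, beq_iff_eq]
  constructor
  · rintro ⟨⟨hab, -⟩, h0⟩
    refine ⟨hab, ?_⟩
    rcases hR.dom a b ha hb hab with h | ⟨-, h⟩ | ⟨-, h, -⟩
    · rw [h0] at h; exact absurd h (by unfold UNL; norm_num)
    · exact h
    · exact absurd h0 h
  · rintro ⟨hab, hg⟩
    obtain ⟨t'', hT, hat, hbt⟩ := M.contact_side a b ha hb hab hg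
    obtain ⟨t, ht, e⟩ := hall t'' hT
    have hat' : a ∈ tset t := by rw [e]; exact hat
    have hbt' : b ∈ tset t := by rw [e]; exact hbt
    have hsc : s.gsc a b ≠ 0 := by
      rw [gsc_eq_length hR ha hb hab]
      intro h0
      have : t ∈ s.onSideL a b := by
        unfold St.onSideL; rw [List.mem_filter]; simp only [Bool.and_eq_true]
        exact ⟨ht, tmem_iff.2 hat', tmem_iff.2 hbt'⟩
      rw [List.length_eq_zero_iff.1 h0] at this; simp at this
    refine ⟨⟨hab, hsc⟩, ?_⟩
    have hl := hR.side_lab t ht a hat' b hbt' hab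
    rcases hR.dom a b ha hb hab with h | ⟨h, -⟩ | ⟨-, -, h, -⟩
    · exact absurd h hl
    · exact h
    · exact absurd hg h

end Complete

end GSearch

end Summit.Ventures.Crystal3D.Kissing125
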